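import Summits.Ventures.YMGap.RobustBall.CouplingDerivativeOnBallS
import HarnessLib

/-!
# Venture YMGap, track ROBUST-BALL (Y2) — cells of `CouplingDerivativeOnBallS`: EVERY `N ≥ 2`, EVERY `d` (Bakry–Émery one-link input) and
# the `SU(2)` Wilson state on `ℤ⁴`, `C¹` in the coupling on the whole two-sided window `|β_W| < 1/6`, for every DLR selection

HONEST FRAMING. WHAT THIS IS: a venture file (cell `pub-ymgap`, track Y2 ROBUST-BALL, seat rb-p1, theorems only).
* `suN_hasDerivAt_integral_coupling_bakryEmery` — every `N ≥ 2`, every `d ≥ 1`, HYPOTHESIS-FREE: `b := 2(d−1)|β| < 1/2`,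
  `6(d−1)|β| e^{a'} e^{t}/(1/2 − b) + e^{a'/2} Λ'/√(N(1/2 − b)) < 1`, `W ∈ MemBallZdS a Λ t`, `a + s₀|κ|·4(d−1)N ≤ a'`, `Λ + s₀|κ|·e^{t}8(d−1)√N ≤ Λ'`
  ⇒ for every selection `ν(s) ∈ 𝒢(perturbedYMS (Nβ + sκ) W)` and bounded local Lipschitz `F`: derivative `−Σ'_X cov(F, (κ·wilsonDirection)_X)` at every
  `|s| < s₀` and `ContDiffOn ℝ 1` (the Shen–Zhu–Zhu/Bakry–Émery one-link input `oneLinkPoincareSUN_bakryEmery`).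
The Wilson-point corollary (member `W = 0`), localised: for every `β_W ∈ (−1/6, 1/6)` small loads `s₀ = t > 0` close the `SU(2)` tier-2 pair
door `6|β_W| e^{13 s₀} + e^{7 s₀} √(2/3)·12√2·s₀ < 1`, so
* ★ `su2_wilson_hasDerivAt_integral_coupling` — for every selection `ν(β_W) ∈ 𝒢_{β_W}` on `(−1/6, 1/6)` (bare coupling `β_W/2`; the DLR state is
  unique there, so the selection is THE strong-coupling state) and every Lipschitz cylinder `F`: at every `|β_W| < 1/6`,
  `HasDerivAt (β_W ↦ ∫ F dν(β_W)) (−Σ'_X cov_{ν(β_W)}(F, (½·wilsonDirection)_X)) β_W`;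
* ★ `su2_wilson_contDiffOn_integral_coupling` — `β_W ↦ ∫ F dν(β_W)` is `ContDiffOn ℝ 1` on `(−1/6, 1/6)`.
WHAT THIS IS NOT: ds-1's `CouplingDerivative.lean` proves the same `C¹` statement on `(0, 9/25)` by torus limits (a larger positive window);
this file adds the two-sided window around `β_W = 0` by the infinite-volume route; `C¹`, not analytic; nothing about the continuum limit or a
Clay-sense mass gap.
-/

noncomputable section

open MeasureTheory Function Finset ProbabilityTheory Real Filter Topology
open scoped NNReal
open Literature.Probability.LatticeModels
open Literature.Probability.LatticeModels.DobrushinMetric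
open Literature.MathematicalPhysics.QuantumLattice
open Literature.MathematicalPhysics.QuantumFieldTheory hiding ZdEdge
open Summit.QuantumFields.BalabanUV.InfraRed.StrongCouplingPoincareDoorSUN (oneLinkPoincareSUN_bakryEmery)
open Summit.QuantumFields.BalabanUV.InfraRed.StrongCouplingVarianceDoorSUN (oneLinkVarianceBound_bakryEmery)

namespace Summit.Ventures.YMGap.RobustBall

variable {d N : ℕ}

/-! ### Every `N ≥ 2`, every `d`: the Bakry–Émery cell -/

/-- **EVERY `N ≥ 2`, EVERY `d ≥ 1` — THE STATE OF EVERY MEMBER OF THE WEIGHTED BALL IS `C¹` IN THE COUPLING (Bakry–Émery one-link input,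
hypothesis-free).**  `t > 0`, `s₀ > 0`, `b := |β|·2(d−1) < 1/2`, `6(d−1)|β| e^{a'} e^{t}/(1/2 − b) + e^{a'/2} Λ'/√(N(1/2 − b)) < 1`, `W ∈ MemBallZdS a Λ t`
('t Hooft coupling `β`), `a + s₀|κ|·4(d−1)N ≤ a'`, `Λ + s₀|κ|·e^{t}8(d−1)√N ≤ Λ'`: for every selection `ν(s) ∈ 𝒢(perturbedYMS (Nβ + sκ) W)` on
`|s| ≤ s₀` and every bounded local `F` with Frobenius-Lipschitz vector `δ_F`: (i) `HasDerivAt (s ↦ ∫ F dν(s)) (−Σ'_X cov_{ν(s)}(F, (κ·wilsonDirection)_X)) s`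
at every `|s| < s₀`; (ii) `ContDiffOn ℝ 1` on `(−s₀, s₀)`. -/
theorem suN_hasDerivAt_integral_coupling_bakryEmery (hd : 1 ≤ d) (hN : 2 ≤ N) {β a' Λ' t a Λ s₀ κ : ℝ} (ht : 0 < t) (hs₀ : 0 < s₀)
    (hb : |β| * (2 * ((d : ℝ) - 1)) < 1 / 2)
    (hρ : 6 * ((d : ℝ) - 1) * |β| * (exp a' * exp t) / (1 / 2 - |β| * (2 * ((d : ℝ) - 1))) +
      exp (a' / 2) * Λ' / Real.sqrt ((N : ℝ) * (1 / 2 - |β| * (2 * ((d : ℝ) - 1)))) < 1)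
    {W : Potential (ZdEdge d) (Matrix.specialUnitaryGroup (Fin N) ℂ)} (hW : MemBallZdS a Λ t W)
    (ha' : a + s₀ * (|κ| * (4 * ((d : ℝ) - 1) * N)) ≤ a') (hΛ' : Λ + s₀ * (|κ| * (exp t * (8 * ((d : ℝ) - 1) * Real.sqrt N))) ≤ Λ')
    {ν : ℝ → Measure (LGConfig d (Matrix.specialUnitaryGroup (Fin N) ℂ))}
    (hν : ∀ s ∈ Set.Icc (-s₀) s₀, ν s ∈ perturbedGibbsMeasuresS (d := d) (fundamentalRep (Fin N)) (N * β + s * κ) W)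
    {F : LGConfig d (Matrix.specialUnitaryGroup (Fin N) ℂ) → ℝ} (hFm : Measurable F) {ΛF : Finset (ZdEdge d)}
    (hFdep : DependsOn F (↑ΛF : Set (ZdEdge d))) {MF : ℝ} (hMF : ∀ σ, |F σ| ≤ MF) {δF : ZdEdge d → ℝ}
    (hδF : IsLipBound suFrobDist F δF) :
    (∀ s ∈ Set.Ioo (-s₀) s₀, HasDerivAt (fun s => ∫ U, F U ∂(ν s))
        (-(∑' X : Finset (ZdEdge d), cov[F, (κ • (wilsonDirection : Potential (ZdEdge d) (Matrix.specialUnitaryGroup (Fin N) ℂ))) X; ν s])) s) ∧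
      ContDiffOn ℝ 1 (fun s => ∫ U, F U ∂(ν s)) (Set.Ioo (-s₀) s₀) := by
  set bb : ℝ := |β| * (2 * ((d : ℝ) - 1)) with hbdef
  have hNpos : (0 : ℝ) < N := by exact_mod_cast (show 0 < N by omega)
  have hgap : 0 < 1 / 2 - bb := by linarith
  have hP := oneLinkPoincareSUN_bakryEmery hN hb
  have hV := oneLinkVarianceBound_bakryEmery hN hb
  have hc : (0 : ℝ) ≤ 1 / ((N : ℝ) * (1 / 2 - bb)) := by positivity
  have hv : (0 : ℝ) ≤ (N : ℝ) / (1 / 2 - bb) := by positivity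
  have hsq1 : Real.sqrt (1 / ((N : ℝ) * (1 / 2 - bb)) * ((N : ℝ) / (1 / 2 - bb))) = 1 / (1 / 2 - bb) := by
    rw [show 1 / ((N : ℝ) * (1 / 2 - bb)) * ((N : ℝ) / (1 / 2 - bb)) = (1 / (1 / 2 - bb)) ^ 2 by field_simp,
      Real.sqrt_sq (by positivity)]
  have hsq2 : Real.sqrt (1 / ((N : ℝ) * (1 / 2 - bb))) = 1 / Real.sqrt ((N : ℝ) * (1 / 2 - bb)) := by
    rw [Real.sqrt_div' _ (mul_nonneg hNpos.le hgap.le), Real.sqrt_one]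
  have hρ' : 6 * ((d : ℝ) - 1) * |β| * (exp a' * exp t * Real.sqrt (1 / ((N : ℝ) * (1 / 2 - bb)) * ((N : ℝ) / (1 / 2 - bb)))) +
      exp (a' / 2) * Real.sqrt (1 / ((N : ℝ) * (1 / 2 - bb))) * Λ' < 1 := by
    rw [hsq1, hsq2]
    calc 6 * ((d : ℝ) - 1) * |β| * (exp a' * exp t * (1 / (1 / 2 - bb))) + exp (a' / 2) * (1 / Real.sqrt ((N : ℝ) * (1 / 2 - bb))) * Λ'
        = 6 * ((d : ℝ) - 1) * |β| * (exp a' * exp t) / (1 / 2 - bb) + exp (a' / 2) * Λ' / Real.sqrt ((N : ℝ) * (1 / 2 - bb)) := by ring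
      _ < 1 := hρ
  exact hasDerivAt_integral_coupling_S hd (by omega) hc hv le_rfl (fun B hB => hP B hB) (fun B hB => hV B hB) ht hρ' hW hs₀ ha' hΛ' hν
    hFm hFdep hMF hδF

/-! ### The `SU(2)` Wilson state on `ℤ⁴`: the two-sided window `|β_W| < 1/6` -/

/-- **Small loads close the door at every `|β_W| < 1/6`**: there is `s₀ > 0` with `s₀ < 1/6 − |β_W|` and
`6|β_W| e^{12 s₀} e^{s₀} + e^{12 s₀/2} √(2/3) (12√2 e^{s₀} s₀) < 1` (continuity at `s₀ = 0`, where the left side is `6|β_W| < 1`). -/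
theorem exists_loads_su2_wilson {βW : ℝ} (h : |βW| < 1 / 6) :
    ∃ s₀ : ℝ, 0 < s₀ ∧ s₀ < 1 / 6 - |βW| ∧
      6 * |βW| * (exp (12 * s₀) * exp s₀) + exp (12 * s₀ / 2) * Real.sqrt (2 / 3) * (12 * Real.sqrt 2 * exp s₀ * s₀) < 1 := by
  set f : ℝ → ℝ := fun s => 6 * |βW| * (exp (12 * s) * exp s) + exp (12 * s / 2) * Real.sqrt (2 / 3) * (12 * Real.sqrt 2 * exp s * s)
    with hf
  have hcont : Continuous f := by
    simp only [hf]
    fun_prop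
  have h0 : f 0 < 1 := by simp only [hf]; norm_num; linarith
  have hev : ∀ᶠ s in 𝓝 (0 : ℝ), f s < 1 := hcont.continuousAt.eventually (eventually_lt_nhds h0)
  have hev2 : ∀ᶠ s in 𝓝 (0 : ℝ), s < 1 / 6 - |βW| := eventually_lt_nhds (by linarith)
  obtain ⟨ε, hε, hball⟩ := Metric.eventually_nhds_iff.1 (hev.and hev2)
  refine ⟨ε / 2, by positivity, ?_, ?_⟩
  · exact (hball (by rw [Real.dist_eq, sub_zero, abs_of_pos (by positivity)]; linarith)).2
  · exact (hball (by rw [Real.dist_eq, sub_zero, abs_of_pos (by positivity)]; linarith)).1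

/-- ★ **THE `SU(2)` WILSON STATE ON `ℤ⁴` IS DIFFERENTIABLE IN THE COUPLING ON `|β_W| < 1/6`, with the fluctuation–response formula.**  For every
selection `ν(b) ∈ 𝒢_b(Wilson)` on `b ∈ (−1/6, 1/6)` (bare coupling `b/2`) and every Lipschitz cylinder `F`, at every `|β_W| < 1/6`:
`HasDerivAt (b ↦ ∫ F dν(b)) (−Σ'_X cov_{ν(β_W)}(F, (½·wilsonDirection)_X)) β_W`. -/
theorem su2_wilson_hasDerivAt_integral_coupling {ν : ℝ → Measure (LGConfig 4 (Matrix.specialUnitaryGroup (Fin 2) ℂ))}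
    (hν : ∀ b ∈ Set.Ioo (-(1 / 6 : ℝ)) (1 / 6), ν b ∈ perturbedGibbsMeasuresS (d := 4) (fundamentalRep (Fin 2)) (2 * (b / 4)) 0)
    {F : LGConfig 4 (Matrix.specialUnitaryGroup (Fin 2) ℂ) → ℝ} {ΛF : Finset (ZdEdge 4)} {KF : ℝ≥0}
    (hF : IsLipschitzCylinder (fundamentalRep (Fin 2)) F ΛF KF) {βW : ℝ} (hβ : βW ∈ Set.Ioo (-(1 / 6 : ℝ)) (1 / 6)) :
    HasDerivAt (fun b => ∫ U, F U ∂(ν b))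
      (-(∑' X : Finset (ZdEdge 4), cov[F, (((1 : ℝ) / 2) • (wilsonDirection : Potential (ZdEdge 4) (Matrix.specialUnitaryGroup (Fin 2) ℂ))) X;
        ν βW])) βW := by
  have habs : |βW| < 1 / 6 := abs_lt.2 ⟨hβ.1, hβ.2⟩
  obtain ⟨s₀, hs₀, hgap, hdoor⟩ := exists_loads_su2_wilson habs
  -- the re-centred selection `s ↦ ν(β_W + s)` on `|s| ≤ s₀`
  have hν' : ∀ s ∈ Set.Icc (-s₀) s₀, ν (βW + s) ∈
      perturbedGibbsMeasuresS (d := 4) (fundamentalRep (Fin 2)) (2 * ((βW + s) / 4)) 0 := fun s hs => by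
    have h1 := le_abs_self βW; have h2 := neg_abs_le βW
    exact hν (βW + s) ⟨by linarith [hs.1], by linarith [hs.2]⟩
  have key := (su2_hasDerivAt_integral_coupling_dim4 (a := 0) (Λ := 0) (a' := 12 * s₀) (Λ' := 12 * Real.sqrt 2 * exp s₀ * s₀) hs₀ hs₀
    hdoor (memBallZdS_zero le_rfl le_rfl) (by linarith) (by linarith) hν' hF).1 0 ⟨by linarith, hs₀⟩
  have h2 := HasDerivAt.comp_sub_const βW βW (f := fun s => ∫ U, F U ∂(ν (βW + s))) (by rw [sub_self]; exact key)
  simp only [add_zero, add_sub_cancel] at h2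
  exact h2

/-- ★ **THE `SU(2)` WILSON STATE ON `ℤ⁴` IS `C¹` IN THE COUPLING ON `(−1/6, 1/6)`**: for every selection `ν` as above and every Lipschitz cylinder
`F`, `b ↦ ∫ F dν(b)` is `ContDiffOn ℝ 1` on `(−1/6, 1/6)`. -/
theorem su2_wilson_contDiffOn_integral_coupling {ν : ℝ → Measure (LGConfig 4 (Matrix.specialUnitaryGroup (Fin 2) ℂ))}
    (hν : ∀ b ∈ Set.Ioo (-(1 / 6 : ℝ)) (1 / 6), ν b ∈ perturbedGibbsMeasuresS (d := 4) (fundamentalRep (Fin 2)) (2 * (b / 4)) 0)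
    {F : LGConfig 4 (Matrix.specialUnitaryGroup (Fin 2) ℂ) → ℝ} {ΛF : Finset (ZdEdge 4)} {KF : ℝ≥0}
    (hF : IsLipschitzCylinder (fundamentalRep (Fin 2)) F ΛF KF) :
    ContDiffOn ℝ 1 (fun b => ∫ U, F U ∂(ν b)) (Set.Ioo (-(1 / 6 : ℝ)) (1 / 6)) := by
  refine contDiffOn_of_locally_contDiffOn fun βW hβ => ?_
  have habs : |βW| < 1 / 6 := abs_lt.2 ⟨hβ.1, hβ.2⟩
  obtain ⟨s₀, hs₀, hgap, hdoor⟩ := exists_loads_su2_wilson habs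
  have hν' : ∀ s ∈ Set.Icc (-s₀) s₀, ν (βW + s) ∈
      perturbedGibbsMeasuresS (d := 4) (fundamentalRep (Fin 2)) (2 * ((βW + s) / 4)) 0 := fun s hs => by
    have h1 := le_abs_self βW; have h2 := neg_abs_le βW
    exact hν (βW + s) ⟨by linarith [hs.1], by linarith [hs.2]⟩
  have key := (su2_hasDerivAt_integral_coupling_dim4 (a := 0) (Λ := 0) (a' := 12 * s₀) (Λ' := 12 * Real.sqrt 2 * exp s₀ * s₀) hs₀ hs₀
    hdoor (memBallZdS_zero le_rfl le_rfl) (by linarith) (by linarith) hν' hF).2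
  refine ⟨Set.Ioo (βW - s₀) (βW + s₀), isOpen_Ioo, ⟨by linarith, by linarith⟩, ?_⟩
  refine ContDiffOn.mono ?_ Set.inter_subset_right
  have hsub : ContDiffOn ℝ 1 (fun b : ℝ => b - βW) (Set.Ioo (βW - s₀) (βW + s₀)) := (contDiff_id.sub contDiff_const).contDiffOn
  have hmaps : Set.MapsTo (fun b : ℝ => b - βW) (Set.Ioo (βW - s₀) (βW + s₀)) (Set.Ioo (-s₀) s₀) :=
    fun b hb => ⟨by linarith [hb.1], by linarith [hb.2]⟩
  refine (key.comp hsub hmaps).congr fun b _ => ?_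
  simp only [Function.comp_apply, add_sub_cancel]

end Summit.Ventures.YMGap.RobustBall

end
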